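import Summits.CriticalPhenomena.PercolationContinuityZ3.Theorems.PercNearOneGluingNoHeavyLowerTailCubicThreePointJoinClosure
import Mathlib.Tactic.Ring
import Mathlib.Tactic.Linarith
import Mathlib.Tactic.Positivity
import HarnessLib

/-!
# `NoHeavyLowerTail` (stmt-CriticalPhenomena-4575) — the sharp cubic row `Hmax3 ≥ 0` holds for EVERY series–parallel three-terminal law

Support file (prover prim-gen-kcluster gen 9, k-cluster line; `--supports stmt-CriticalPhenomena-4575`).  One inductive definition (the class of
series–parallel laws) and its membership theorem; everything else is imported (`…CubicThreePointJoinClosure`: the K3-semigroup theorem;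
`…CubicThreePointTerminalClosure`: `AG`, `Ha`, `Hb`, `Hqt`).  Cells `(q,u₁,u₂,u₃,t) = (P(a|b|c), P(ab|c), P(ac|b), P(bc|a), P(abc))`.

`SPLaw q u₁ u₂ u₃ t` — the law is generated from the TWO-POINT laws of monotone one-bit systems (a chord `B/Pᵢ`, a pendant arm `Pᵢ/T`,
the all-or-nothing law `B/T`) by PARALLEL composition (join of the two independent partitions: `z_q = qQ`, `z_i = q vᵢ + uᵢ Q + uᵢ vᵢ`,
`z_t = tσ' + Tσ − tT + Σ_{i≠j} uᵢvⱼ`) and its dual MEET composition.  These are exactly the laws of read-once monotone `∧/∨`-formulas with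
independent leaf bits valued in the chains of the partition lattice `M₃` ("series–parallel 3-sunflower systems"); as graphs they include all
stars (meets of three pendant arms), triangles (joins of three chords), `K₄ = star ⊔ triangle`, `K_{2,3} = star ⊔ star`, hubs in parallel with
arbitrary arm probabilities, and everything obtained from these by terminal–terminal edges and pendant moves (E/T/H-constructible graphs).

THEOREM (`SPLaw.sharp`).  Every series–parallel law lies in `S₀ = {cells ≥ 0, σ = 1, AG ≥ 0, max(Ha,Hb) ≥ 0}`; i.e. it satisfies Gladkov's
`AG ≥ 0` and the SHARP cubic dichotomy `P(abc)²·… : Ha ≥ 0 ∨ Hb ≥ 0` (⇔ `max(q,t)·AG ≥ e₃`), hence (`…SharpDichotomy`, `…TerminalClosure`) also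
`H_{q+t} ≥ 0`, AG⁺ and SHK3⁺.  Conversely every point of `S₀` with `t > 0` (resp. `q > 0`) is a diluted star = meet of three pendant arms and a
`B/T` law (resp. a clamped triangle), so the series–parallel laws are EXACTLY `S₀` (`…SharpDichotomy`, canonical models); the open conjecture
for general graphs / sunflower systems reads: every 3-point law is series–parallel.
[cite: Gladkov2024StrongFKG, Cor. 4.2 (the quadratic form AG)]; [cite: GladkovZimin2024HK, §4 (one-coordinate decomposition)]
-/

namespace Summit.CriticalPhenomena.PercolationContinuityZ3.Theorems

namespace CubicThreePointJoin

open CubicThreePointTerminal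

/-- The SERIES–PARALLEL three-point laws: generated from the two-point laws of one-bit monotone systems (chords `B/Pᵢ`, pendant arms `Pᵢ/T`,
the glue law `B/T`) by parallel (join) and dual (meet) composition of independent systems. [folklore] -/
inductive SPLaw : ℝ → ℝ → ℝ → ℝ → ℝ → Prop
  | chord₁ {l : ℝ} (h₀ : 0 ≤ l) (h₁ : l ≤ 1) : SPLaw (1 - l) l 0 0 0
  | chord₂ {l : ℝ} (h₀ : 0 ≤ l) (h₁ : l ≤ 1) : SPLaw (1 - l) 0 l 0 0
  | chord₃ {l : ℝ} (h₀ : 0 ≤ l) (h₁ : l ≤ 1) : SPLaw (1 - l) 0 0 l 0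
  | arm₁ {α : ℝ} (h₀ : 0 ≤ α) (h₁ : α ≤ 1) : SPLaw 0 (1 - α) 0 0 α
  | arm₂ {α : ℝ} (h₀ : 0 ≤ α) (h₁ : α ≤ 1) : SPLaw 0 0 (1 - α) 0 α
  | arm₃ {α : ℝ} (h₀ : 0 ≤ α) (h₁ : α ≤ 1) : SPLaw 0 0 0 (1 - α) α
  | glue {p : ℝ} (h₀ : 0 ≤ p) (h₁ : p ≤ 1) : SPLaw (1 - p) 0 0 0 p
  | join {q u₁ u₂ u₃ t Q v₁ v₂ v₃ T : ℝ} (hx : SPLaw q u₁ u₂ u₃ t) (hy : SPLaw Q v₁ v₂ v₃ T) :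
      SPLaw (q * Q) (q * v₁ + u₁ * Q + u₁ * v₁) (q * v₂ + u₂ * Q + u₂ * v₂) (q * v₃ + u₃ * Q + u₃ * v₃)
        (t * (Q + v₁ + v₂ + v₃ + T) + T * (q + u₁ + u₂ + u₃) + (u₁ * (v₂ + v₃) + u₂ * (v₁ + v₃) + u₃ * (v₁ + v₂)))
  | meet {q u₁ u₂ u₃ t Q v₁ v₂ v₃ T : ℝ} (hx : SPLaw q u₁ u₂ u₃ t) (hy : SPLaw Q v₁ v₂ v₃ T) :
      SPLaw (q * (T + v₁ + v₂ + v₃ + Q) + Q * (t + u₁ + u₂ + u₃) + (u₁ * (v₂ + v₃) + u₂ * (v₁ + v₃) + u₃ * (v₁ + v₂)))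
        (t * v₁ + u₁ * T + u₁ * v₁) (t * v₂ + u₂ * T + u₂ * v₂) (t * v₃ + u₃ * T + u₃ * v₃) (t * T)

/-- Series–parallel laws are probability vectors: cells `≥ 0`, total mass `1`. [folklore] -/
theorem SPLaw.cells {q u₁ u₂ u₃ t : ℝ} (h : SPLaw q u₁ u₂ u₃ t) :
    0 ≤ q ∧ 0 ≤ u₁ ∧ 0 ≤ u₂ ∧ 0 ≤ u₃ ∧ 0 ≤ t ∧ q + u₁ + u₂ + u₃ + t = 1 := by
  induction h with
  | chord₁ h₀ h₁ => exact ⟨by linarith, h₀, le_rfl, le_rfl, le_rfl, by ring⟩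
  | chord₂ h₀ h₁ => exact ⟨by linarith, le_rfl, h₀, le_rfl, le_rfl, by ring⟩
  | chord₃ h₀ h₁ => exact ⟨by linarith, le_rfl, le_rfl, h₀, le_rfl, by ring⟩
  | arm₁ h₀ h₁ => exact ⟨le_rfl, by linarith, le_rfl, le_rfl, h₀, by ring⟩
  | arm₂ h₀ h₁ => exact ⟨le_rfl, le_rfl, by linarith, le_rfl, h₀, by ring⟩
  | arm₃ h₀ h₁ => exact ⟨le_rfl, le_rfl, le_rfl, by linarith, h₀, by ring⟩
  | glue h₀ h₁ => exact ⟨by linarith, le_rfl, le_rfl, le_rfl, h₀, by ring⟩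
  | @join q u₁ u₂ u₃ t Q v₁ v₂ v₃ T hx hy ihx ihy =>
      obtain ⟨hq, hu₁, hu₂, hu₃, ht, hσ⟩ := ihx
      obtain ⟨hQ, hv₁, hv₂, hv₃, hT, hσ'⟩ := ihy
      refine ⟨by positivity, by positivity, by positivity, by positivity, by positivity, ?_⟩
      linear_combination (Q + v₁ + v₂ + v₃ + T) * hσ + hσ'
  | @meet q u₁ u₂ u₃ t Q v₁ v₂ v₃ T hx hy ihx ihy =>
      obtain ⟨hq, hu₁, hu₂, hu₃, ht, hσ⟩ := ihx
      obtain ⟨hQ, hv₁, hv₂, hv₃, hT, hσ'⟩ := ihy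
      refine ⟨by positivity, by positivity, by positivity, by positivity, by positivity, ?_⟩
      linear_combination (T + v₁ + v₂ + v₃ + Q) * hσ + hσ'

/-- **THEOREM (series–parallel laws satisfy the sharp cubic row).**  Every series–parallel three-point law has `AG ≥ 0` (Gladkov) and
`max(Ha, Hb) ≥ 0`, i.e. `Hmax3 = max(q,t)·AG − e₃ ≥ 0`: `P(abc)² ≥ P(ab)P(ac)P(bc)` or `P(a|b|c)² ≥ ∏ᵢ P(i ∤ rest)`.
(Induction over the formula with the K3-semigroup theorem `maxH_join_nonneg` / `maxH_meet_nonneg`.) [folklore] -/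
theorem SPLaw.sharp {q u₁ u₂ u₃ t : ℝ} (h : SPLaw q u₁ u₂ u₃ t) :
    0 ≤ AG q u₁ u₂ u₃ t ∧ 0 ≤ max (Ha q u₁ u₂ u₃ t) (Hb q u₁ u₂ u₃ t) := by
  induction h with
  | chord₁ h₀ h₁ => simp only [AG, Ha, Hb]; constructor <;> [nlinarith; exact le_max_of_le_left (by nlinarith)]
  | chord₂ h₀ h₁ => simp only [AG, Ha, Hb]; constructor <;> [nlinarith; exact le_max_of_le_left (by nlinarith)]
  | chord₃ h₀ h₁ => simp only [AG, Ha, Hb]; constructor <;> [nlinarith; exact le_max_of_le_left (by nlinarith)]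
  | arm₁ h₀ h₁ => simp only [AG, Ha, Hb]; constructor <;> [nlinarith; exact le_max_of_le_left (by nlinarith)]
  | arm₂ h₀ h₁ => simp only [AG, Ha, Hb]; constructor <;> [nlinarith; exact le_max_of_le_left (by nlinarith)]
  | arm₃ h₀ h₁ => simp only [AG, Ha, Hb]; constructor <;> [nlinarith; exact le_max_of_le_left (by nlinarith)]
  | @glue p h₀ h₁ =>
      simp only [AG, Ha, Hb]
      have hp : 0 ≤ p * ((1 - p) * p - (0 * 0 + 0 * 0 + 0 * 0)) - 0 * 0 * 0 := by
        nlinarith [mul_nonneg (mul_nonneg h₀ h₀) (sub_nonneg.mpr h₁)]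
      exact ⟨by nlinarith [mul_nonneg h₀ (sub_nonneg.mpr h₁)], le_max_of_le_left hp⟩
  | @join q u₁ u₂ u₃ t Q v₁ v₂ v₃ T hx hy ihx ihy =>
      obtain ⟨hq, hu₁, hu₂, hu₃, ht, -⟩ := hx.cells
      obtain ⟨hQ, hv₁, hv₂, hv₃, hT, -⟩ := hy.cells
      exact ⟨AG_join_nonneg hq hu₁ hu₂ hu₃ ht hQ hv₁ hv₂ hv₃ ihx.1 ihy.1 rfl rfl rfl rfl rfl,
        maxH_join_nonneg hq hu₁ hu₂ hu₃ ht hQ hv₁ hv₂ hv₃ hT ihx.1 ihy.1 ihx.2 ihy.2 rfl rfl rfl rfl rfl⟩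
  | @meet q u₁ u₂ u₃ t Q v₁ v₂ v₃ T hx hy ihx ihy =>
      obtain ⟨hq, hu₁, hu₂, hu₃, ht, -⟩ := hx.cells
      obtain ⟨hQ, hv₁, hv₂, hv₃, hT, -⟩ := hy.cells
      have h := maxH_meet_nonneg hq hu₁ hu₂ hu₃ ht hQ hv₁ hv₂ hv₃ hT ihx.1 ihy.1 ihx.2 ihy.2 rfl rfl rfl rfl rfl
      exact ⟨h.2, h.1⟩

/-- Corollary: in the regime `P(abc) ≥ P(a|b|c)` every series–parallel law satisfies `P(abc)² ≥ P(ab)·P(ac)·P(bc)` (`Ha ≥ 0`), and in the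
regime `P(a|b|c) ≥ P(abc)` it satisfies `P(a|b|c)² ≥ ∏ᵢ P(i ∤ rest)` (`Hb ≥ 0`). [folklore] -/
theorem SPLaw.Ha_nonneg_of_dense {q u₁ u₂ u₃ t : ℝ} (h : SPLaw q u₁ u₂ u₃ t) (hqt : q ≤ t) :
    0 ≤ Ha q u₁ u₂ u₃ t := by
  obtain ⟨hag, hmax⟩ := h.sharp
  rcases le_max_iff.mp hmax with ha | hb
  · exact ha
  · have hsub := Ha_sub_Hb q u₁ u₂ u₃ t
    have : 0 ≤ (t - q) * AG q u₁ u₂ u₃ t := mul_nonneg (by linarith) hag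
    linarith

/-- Dual corollary (`q ≥ t` ⇒ `Hb ≥ 0`). [folklore] -/
theorem SPLaw.Hb_nonneg_of_sparse {q u₁ u₂ u₃ t : ℝ} (h : SPLaw q u₁ u₂ u₃ t) (htq : t ≤ q) :
    0 ≤ Hb q u₁ u₂ u₃ t := by
  obtain ⟨hag, hmax⟩ := h.sharp
  rcases le_max_iff.mp hmax with ha | hb
  · have hsub := Ha_sub_Hb q u₁ u₂ u₃ t
    have : (t - q) * AG q u₁ u₂ u₃ t ≤ 0 := mul_nonpos_of_nonpos_of_nonneg (by linarith) hag
    linarith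
  · exact hb

/-! ### The weaker cubic rows on the series–parallel class -/

/-- Every series–parallel law satisfies `H_{q+t} = (q+t)·AG − e₃ ≥ 0` (from `Hmax3` via `Hqt_ge_max`). [folklore] -/
theorem SPLaw.Hqt_nonneg {q u₁ u₂ u₃ t : ℝ} (h : SPLaw q u₁ u₂ u₃ t) : 0 ≤ Hqt q u₁ u₂ u₃ t := by
  obtain ⟨hq, -, -, -, ht, -⟩ := h.cells
  obtain ⟨hag, hmax⟩ := h.sharp
  exact hmax.trans (CubicThreePointSharp.Hqt_ge_max hq ht hag)

/-- Every series–parallel law satisfies AG⁺ (`Ξ = σ·AG − e₃ ≥ 0`, i.e. `q t ≥ e₂ + e₃` on the simplex). [folklore] -/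
theorem SPLaw.Xi_nonneg {q u₁ u₂ u₃ t : ℝ} (h : SPLaw q u₁ u₂ u₃ t) : 0 ≤ Xi q u₁ u₂ u₃ t := by
  obtain ⟨hq, hu₁, hu₂, hu₃, ht, -⟩ := h.cells
  obtain ⟨hag, -⟩ := h.sharp
  have hH := h.Hqt_nonneg
  have e1 : Xi q u₁ u₂ u₃ t = Hqt q u₁ u₂ u₃ t + (u₁ + u₂ + u₃) * AG q u₁ u₂ u₃ t := by
    simp only [Xi, Hqt, AG]; ring
  rw [e1]
  have : 0 ≤ (u₁ + u₂ + u₃) * AG q u₁ u₂ u₃ t := mul_nonneg (by linarith) hag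
  linarith

/-- Every series–parallel law satisfies SHK3⁺ (`F = (σ+t)·AG − e₃ ≥ 0`, i.e. `∏(1+P(Uᵢ)) ≤ (1+P(T))(1+ΣP(Uᵢ))`). [folklore] -/
theorem SPLaw.F_nonneg {q u₁ u₂ u₃ t : ℝ} (h : SPLaw q u₁ u₂ u₃ t) : 0 ≤ CubicThreePointStep.F q u₁ u₂ u₃ t := by
  obtain ⟨hq, hu₁, hu₂, hu₃, ht, -⟩ := h.cells
  obtain ⟨hag, -⟩ := h.sharp
  have hXi := h.Xi_nonneg
  have e1 : CubicThreePointStep.F q u₁ u₂ u₃ t = Xi q u₁ u₂ u₃ t + t * AG q u₁ u₂ u₃ t := by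
    simp only [CubicThreePointStep.F, Xi, AG]; ring
  rw [e1]
  have : 0 ≤ t * AG q u₁ u₂ u₃ t := mul_nonneg ht hag
  linarith

/-! ### The terminal operations, stars and triangles stay inside the class -/

/-- STAR laws (hub with independent arms `α, β, γ`; cells in the convention `u₁ = ab|c, u₂ = ac|b, u₃ = bc|a`) are series–parallel:
the meet of the three pendant-arm laws. [folklore] -/
theorem SPLaw.star {α β γ : ℝ} (hα₀ : 0 ≤ α) (hα₁ : α ≤ 1) (hβ₀ : 0 ≤ β) (hβ₁ : β ≤ 1) (hγ₀ : 0 ≤ γ) (hγ₁ : γ ≤ 1) :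
    SPLaw (1 - (α * β + α * γ + β * γ) + 2 * (α * β * γ)) (α * β * (1 - γ)) (α * γ * (1 - β)) (β * γ * (1 - α))
      (α * β * γ) := by
  have h := SPLaw.meet (SPLaw.meet (SPLaw.arm₃ hα₀ hα₁) (SPLaw.arm₂ hβ₀ hβ₁)) (SPLaw.arm₁ hγ₀ hγ₁)
  convert h using 1 <;> ring

/-- TRIANGLE laws (independent edges `z = p_ab, y = p_ac, x = p_bc`) are series–parallel: the join of the three chords. [folklore] -/
theorem SPLaw.triangle {x y z : ℝ} (hx₀ : 0 ≤ x) (hx₁ : x ≤ 1) (hy₀ : 0 ≤ y) (hy₁ : y ≤ 1) (hz₀ : 0 ≤ z) (hz₁ : z ≤ 1) :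
    SPLaw ((1 - x) * (1 - y) * (1 - z)) (z * (1 - x) * (1 - y)) (y * (1 - x) * (1 - z)) (x * (1 - y) * (1 - z))
      (x * y + x * z + y * z - 2 * (x * y * z)) := by
  have h := SPLaw.join (SPLaw.join (SPLaw.chord₁ hz₀ hz₁) (SPLaw.chord₂ hy₀ hy₁)) (SPLaw.chord₃ hx₀ hx₁)
  convert h using 1 <;> ring

/-- The class is closed under the terminal–terminal edge `E_ab^l` of `…TerminalClosure` (= join with a chord). [folklore] -/
theorem SPLaw.edge_ab {q u₁ u₂ u₃ t l : ℝ} (h : SPLaw q u₁ u₂ u₃ t) (hl₀ : 0 ≤ l) (hl₁ : l ≤ 1) :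
    SPLaw ((1 - l) * q) (u₁ + l * q) ((1 - l) * u₂) ((1 - l) * u₃) (t + l * (u₂ + u₃)) := by
  have h' := SPLaw.join h (SPLaw.chord₁ hl₀ hl₁)
  convert h' using 1 <;> ring

/-- The class is closed under the pendant move `T_a^l` of `…TerminalClosure` (= meet with a pendant-arm law). [folklore] -/
theorem SPLaw.pendant_a {q u₁ u₂ u₃ t l : ℝ} (h : SPLaw q u₁ u₂ u₃ t) (hl₀ : 0 ≤ l) (hl₁ : l ≤ 1) :
    SPLaw (q + l * (u₁ + u₂)) ((1 - l) * u₁) ((1 - l) * u₂) (u₃ + l * t) ((1 - l) * t) := by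
  have hm₀ : 0 ≤ 1 - l := by linarith
  have hm₁ : 1 - l ≤ 1 := by linarith
  have h' := SPLaw.meet h (SPLaw.arm₃ hm₀ hm₁)
  convert h' using 1 <;> ring

/-- The class is closed under the CLAMP `K_ε` (glue all three terminals with probability `ε`; = join with the glue law). [folklore] -/
theorem SPLaw.clamp {q u₁ u₂ u₃ t ε : ℝ} (h : SPLaw q u₁ u₂ u₃ t) (hε₀ : 0 ≤ ε) (hε₁ : ε ≤ 1) :
    SPLaw ((1 - ε) * q) ((1 - ε) * u₁) ((1 - ε) * u₂) ((1 - ε) * u₃) ((1 - ε) * t + ε) := by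
  obtain ⟨-, -, -, -, -, hσ⟩ := h.cells
  have h' := SPLaw.join h (SPLaw.glue hε₀ hε₁)
  convert h' using 1
  case e'_5 => linear_combination (-ε) * hσ
  all_goals ring

/-- The class is closed under the DILUTION `Δ_ε` (separate everything with probability `ε`; = meet with the glue law). [folklore] -/
theorem SPLaw.dilute {q u₁ u₂ u₃ t ε : ℝ} (h : SPLaw q u₁ u₂ u₃ t) (hε₀ : 0 ≤ ε) (hε₁ : ε ≤ 1) :
    SPLaw ((1 - ε) * q + ε) ((1 - ε) * u₁) ((1 - ε) * u₂) ((1 - ε) * u₃) ((1 - ε) * t) := by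
  obtain ⟨-, -, -, -, -, hσ⟩ := h.cells
  have hm₀ : 0 ≤ 1 - ε := by linarith
  have hm₁ : 1 - ε ≤ 1 := by linarith
  have h' := SPLaw.meet h (SPLaw.glue hm₀ hm₁)
  convert h' using 1
  case e'_1 => linear_combination (-ε) * hσ
  all_goals ring

end CubicThreePointJoin

end Summit.CriticalPhenomena.PercolationContinuityZ3.Theorems
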